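import Mathlib
import HarnessLib
import Summits.AtomisticToContinuum.FouriersLaw.Theses.JunctionLocality
import Summits.AtomisticToContinuum.FouriersLaw.Theorems.JunctionLocalityConductanceLowerBoundContactCertificateTransmission
import Summits.AtomisticToContinuum.FouriersLaw.Theorems.JunctionLocalitySuperadditiveResistanceKuboResolvent

/-!
# Contact formation for resolvent fields, I: the transmission INEQUALITY

Helper file (`--supports` stmt-AtomisticToContinuum-11749) for stub `stub_contactFormation_resolvent` (R4λ) of the line
`cold-bath-relocation-walk` of the crux `JunctionLocality.ConductanceLowerBound` (lead c2 worker).  For the pinned chain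
`pinnedChain ω₂ lam β γ` (`ω₂ > 0`, `lam, β ≥ 0`, `γ > 0`), `T > 0`, `L ≥ 2`, `λ ≥ 0` and every classical `C² ∩ L²(μ_T)`
solution `u` of the RESOLVENT problem of the adjacent-contact device (hot bath on site `0`, cold bath on site `1`),
`λ u − (X_H u + γ(S_0 + S_1) u) = p_0² − T`:

* finite entropy production at both contacts, `∂_{p_0} u, ∂_{p_1} u ∈ L²(μ_T)` (`Kubo.memLp_partialP` with the shifted
  source `k_0 − λ u ∈ L²(μ_T)`, weights `𝟙_0 + 𝟙_1`);
* the TRANSMISSION INEQUALITY (`contactResolvent_transmission`, registered):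
  `γ(1 − γ s/T²) ≥ (γ³/T)·(‖p_0/γ − ∂_{p_0}u‖² + ‖∂_{p_1}u‖²)`, `s = ⟨u, p_0² − T⟩_{μ_T}` — the `λ = 0` transmission FORM
  (`contact_transmission`) acquires the non-negative mass term `+ (γ²/T²) λ ‖u‖²`: fluctuation–dissipation with a mass
  term `s = λ‖u‖² + γT(‖∂_{p_0}u‖² + ‖∂_{p_1}u‖²)` (landed `Kubo.resolvent_fd`), the Gaussian projection
  `s = T⟨∂_{p_0}u, p_0⟩` (`integral_mul_sq_sub_gibbsMeasure`) and equipartition `⟨p_0²⟩ = T`.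

References: Eckmann–Pillet–Rey-Bellet 1999 §3; Rey-Bellet 2003 Rem. 4.4; folklore.
-/

noncomputable section

open MeasureTheory Filter Topology
open scoped ContDiff
open Literature.MathematicalPhysics.KineticTheory.HeatConduction
open Summit.AtomisticToContinuum.FouriersLaw.Theorems.SuperadditiveResistance.DeviceLiouville
  (kin thermo kin_eq_sq continuous_kin liouvilleOp bathOp)
open Summit.AtomisticToContinuum.FouriersLaw.Theorems.SuperadditiveResistance.Kubo (memLp_partialP resolvent_fd)
open Summit.AtomisticToContinuum.FouriersLaw.Cruxes.SuperadditiveResistance.FloatingProbeBypassLaplacian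
  (pinnedChain_memLp_two_snd pinnedChain_memLp_two_snd_sq pinnedChain_integral_snd_sq integral_mul_sq_sub_gibbsMeasure)

namespace Summit.AtomisticToContinuum.FouriersLaw.Cruxes.ConductanceLowerBound.ColdBathRelocationWalk

variable {ω₂ lam β γ : ℝ} {L : ℕ}

/-- The resolvent equation of the adjacent-contact device in the weighted pair form of the Kubo toolkit:
`1·X_H u + γ S_{𝟙_0+𝟙_1} u = −((p_0² − T) − λ u)` (a forward pair with the SHIFTED source `k_0 − λu`). [folklore] -/
theorem contactResolvent_pair {T l : ℝ} {u : PhaseSpace L → ℝ}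
    (hres : ∀ x, l * u x - (liouvilleOp (pinnedChain ω₂ lam β γ) L u x + γ * (thermo L 0 T u x + thermo L 1 T u x)) =
      kin L 0 x - T) (x : PhaseSpace L) :
    1 * liouvilleOp (pinnedChain ω₂ lam β γ) L u x +
      γ * bathOp L (fun i : Fin L => (if i.val = 0 then 1 else 0) + (if i.val = 1 then 1 else 0)) T u x =
      -((kin L 0 x - T) - l * u x) := by
  rw [one_mul, contact_bathOp_two]
  linarith [hres x]

/-- **Registered helper `contactResolvent_transmission` (R4λ `stub_contactFormation_resolvent`, line `cold-bath-relocation-walk`):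
ENTROPY PRODUCTION AND TRANSMISSION INEQUALITY FOR RESOLVENT FIELDS OF THE ADJACENT-CONTACT DEVICE.**  For `λ ≥ 0` and every
classical `C² ∩ L²(μ_T)` solution `u` of `λu − (X_H u + γ(S_0 + S_1)u) = p_0² − T` (`L ≥ 2`): `∂_{p_0}u, ∂_{p_1}u ∈ L²(μ_T)` and
`(γ³/T)(‖p_0/γ − ∂_{p_0}u‖² + ‖∂_{p_1}u‖²) ≤ γ(1 − γ⟨u, p_0² − T⟩/T²)` (equality up to the mass term `(γ²/T²)λ‖u‖² ≥ 0`).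
[folklore] -/
theorem contactResolvent_transmission : ∀ {ω₂ lam β γ T : ℝ}, 0 < ω₂ → 0 ≤ lam → 0 ≤ β → 0 < γ → 0 < T → ∀ {L : ℕ} (hL : 2 ≤ L) {l : ℝ}, 0 ≤ l → ∀ {u : PhaseSpace L → ℝ}, ContDiff ℝ 2 u → MemLp u 2 ((pinnedChain ω₂ lam β γ).gibbsMeasure L T) → (∀ x, l * u x - (liouvilleOp (pinnedChain ω₂ lam β γ) L u x + γ * (thermo L 0 T u x + thermo L 1 T u x)) = kin L 0 x - T) → MemLp (partialP (⟨0, by omega⟩ : Fin L) u) 2 ((pinnedChain ω₂ lam β γ).gibbsMeasure L T) ∧ MemLp (partialP (⟨1, by omega⟩ : Fin L) u) 2 ((pinnedChain ω₂ lam β γ).gibbsMeasure L T) ∧ γ ^ 3 / T * ((∫ x, (γ⁻¹ * x.2 ⟨0, by omega⟩ - partialP (⟨0, by omega⟩ : Fin L) u x) ^ 2 ∂((pinnedChain ω₂ lam β γ).gibbsMeasure L T)) + ∫ x, partialP (⟨1, by omega⟩ : Fin L) u x ^ 2 ∂((pinnedChain ω₂ lam β γ).gibbsMeasure L T)) ≤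 γ * (1 - γ / T ^ 2 * ∫ x, u x * (kin L 0 x - T) ∂((pinnedChain ω₂ lam β γ).gibbsMeasure L T)) := by
  -- adapted from `contact_transmission` (the `λ = 0` transmission form), with the mass term of `Kubo.resolvent_fd`
  intro ω₂ lam β γ T hω hl hβ hγ hT L hL l hl0 u huC hu2 hres
  have h0 : 0 < L := by omega
  have h1 : 1 < L := by omega
  set i0 : Fin L := ⟨0, h0⟩ with hi0
  set i1 : Fin L := ⟨1, h1⟩ with hi1
  set P := pinnedChain ω₂ lam β γ with hP
  set μ := P.gibbsMeasure L T with hμ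
  set B : Fin L → ℝ := fun i => (if i.val = 0 then 1 else 0) + (if i.val = 1 then 1 else 0) with hB
  haveI : IsProbabilityMeasure μ := pinnedChain_isProbabilityMeasure_gibbsMeasure hω hl hβ γ L hT
  have hud : Differentiable ℝ u := huC.differentiable two_ne_zero
  -- the forward pair in weighted form, shifted source
  have hBnn : ∀ i, 0 ≤ B i := fun i => contact_twoWeights_nonneg i
  have hB0 : 0 < B i0 := by simp [hB, hi0]
  have hB1 : 0 < B i1 := by simp [hB, hi1]
  have hpg : ∀ x, 1 * liouvilleOp P L u x + γ * bathOp L B T u x = -((kin L 0 x - T) - l * u x) :=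
    fun x => contactResolvent_pair hres x
  -- square integrability of the source, of the shifted source and of the contact gradients
  have hk0L2 : MemLp (fun x => kin L 0 x - T) 2 μ :=
    ((pinnedChain_memLp_two_snd_sq hω hl hβ γ L hT i0).sub (memLp_const T)).ae_eq
      (ae_of_all _ fun x => by simp [kin_eq_sq h0, hi0])
  have hkfL2 : MemLp (fun x => (kin L 0 x - T) - l * u x) 2 μ := hk0L2.sub (hu2.const_mul l)
  have hga : MemLp (partialP i0 u) 2 μ := memLp_partialP hω hl hβ γ L hT B hBnn 1 hγ huC hu2 hkfL2 hpg hB0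
  have hgb : MemLp (partialP i1 u) 2 μ := memLp_partialP hω hl hβ γ L hT B hBnn 1 hγ huC hu2 hkfL2 hpg hB1
  have hp0 : MemLp (fun x : PhaseSpace L => x.2 i0) 2 μ := pinnedChain_memLp_two_snd hω hl hβ γ L hT i0
  -- (D) fluctuation–dissipation with the mass term `λ‖u‖²`
  have hDρ := resolvent_fd hω hl hβ L hT B hBnn 1 hγ l huC hu2 hk0L2 hpg
  rw [hB, contact_sum_twoWeights_mul hL] at hDρ
  have hD : ∫ x, u x * (kin L 0 x - T) ∂μ =
      l * (∫ x, u x ^ 2 ∂μ) + γ * T * ((∫ x, partialP i0 u x ^ 2 ∂μ) + ∫ x, partialP i1 u x ^ 2 ∂μ) := by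
    rw [P.integral_gibbsMeasure, P.integral_gibbsMeasure, P.integral_gibbsMeasure, P.integral_gibbsMeasure, hDρ]
    ring
  -- (P) Gaussian projection
  have hA : ∫ x, u x * (kin L 0 x - T) ∂μ = T * ∫ x, partialP i0 u x * x.2 i0 ∂μ := by
    rw [← integral_mul_sq_sub_gibbsMeasure hω hl hβ γ L hT i0 hud hu2 hga]
    exact integral_congr_ae (ae_of_all _ fun x => by dsimp only; rw [kin_eq_sq h0])
  -- the square `‖p_0/γ − ∂_{p_0} u‖²`
  have iaa : Integrable (fun x => partialP i0 u x ^ 2) μ := hga.integrable_sq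
  have ipp : Integrable (fun x : PhaseSpace L => x.2 i0 ^ 2) μ := hp0.integrable_sq
  have iap : Integrable (fun x => partialP i0 u x * x.2 i0) μ := hga.integrable_mul hp0
  have hsq : ∫ x, (γ⁻¹ * x.2 i0 - partialP i0 u x) ^ 2 ∂μ =
      γ⁻¹ ^ 2 * T - 2 * γ⁻¹ * (∫ x, partialP i0 u x * x.2 i0 ∂μ) + ∫ x, partialP i0 u x ^ 2 ∂μ := by
    have ia : Integrable (fun x : PhaseSpace L => γ⁻¹ ^ 2 * x.2 i0 ^ 2) μ := ipp.const_mul _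
    have ib : Integrable (fun x => 2 * γ⁻¹ * (partialP i0 u x * x.2 i0)) μ := iap.const_mul _
    have iab : Integrable (fun x => γ⁻¹ ^ 2 * x.2 i0 ^ 2 - 2 * γ⁻¹ * (partialP i0 u x * x.2 i0)) μ := ia.sub ib
    have e1 : ∫ x, (γ⁻¹ * x.2 i0 - partialP i0 u x) ^ 2 ∂μ =
        ∫ x, (γ⁻¹ ^ 2 * x.2 i0 ^ 2 - 2 * γ⁻¹ * (partialP i0 u x * x.2 i0)) + partialP i0 u x ^ 2 ∂μ :=
      integral_congr_ae (ae_of_all _ fun x => by ring)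
    rw [e1, integral_add iab iaa, integral_sub ia ib, integral_const_mul, integral_const_mul,
      pinnedChain_integral_snd_sq hω hl hβ γ L hT i0]
  refine ⟨hga, hgb, ?_⟩
  -- the mass term is non-negative
  have hN : 0 ≤ l * ∫ x, u x ^ 2 ∂μ := mul_nonneg hl0 (integral_nonneg fun x => sq_nonneg _)
  have hγ0 : γ ≠ 0 := hγ.ne'
  have hT0 : T ≠ 0 := hT.ne'
  -- names for the five integrals
  set s := ∫ x, u x * (kin L 0 x - T) ∂μ with hs
  set J := ∫ x, partialP i0 u x * x.2 i0 ∂μ with hJ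
  set A0 := ∫ x, partialP i0 u x ^ 2 ∂μ with hA0
  set A1 := ∫ x, partialP i1 u x ^ 2 ∂μ with hA1
  set N := ∫ x, u x ^ 2 ∂μ with hNdef
  have hJ' : J = s / T := by
    rw [hA]; field_simp
  have hA1' : A1 = (s - l * N) / (γ * T) - A0 := by
    rw [hD]; field_simp; ring
  have key : γ ^ 3 / T * ((γ⁻¹ ^ 2 * T - 2 * γ⁻¹ * J + A0) + A1) =
      γ * (1 - γ / T ^ 2 * s) - γ ^ 2 / T ^ 2 * (l * N) := by
    rw [hA1', hJ']
    field_simp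
    ring
  rw [hsq, key]
  have hmass : 0 ≤ γ ^ 2 / T ^ 2 * (l * N) := by positivity
  linarith

end Summit.AtomisticToContinuum.FouriersLaw.Cruxes.ConductanceLowerBound.ColdBathRelocationWalk

end
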